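import Summits.CriticalPhenomena.CardyFormulaZ2.Theses.CardyBoundaryCoulombGas
import Literature.Probability.LatticeModels.RowStatePlanar

/-!
# Planar reachability (line `two-cluster-rate-is-stationary-gap`, stub D2)

Crux `Summit.CriticalPhenomena.CardyFormulaZ2.Theses.CardyBoundaryCoulombGas.StripClusterRates`
(stmt-CriticalPhenomena-13878), line `two-cluster-rate-is-stationary-gap`, stub
`stub_planarReachable` (D2, `= PlanarReachable` of the line file): on the row `Finset.Icc 0 n`
every planar (non-crossing) pattern of the row points `S ⊕ {⋆}` with some site joined to `⋆`
is an iterate `l.foldl (fun r OH => planarRowStep OH.1 OH.2 r)` of `wired`, and every planar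
pattern with no site joined to `⋆` such an iterate of `free` — the converse of "row steps
preserve planarity" (`RowState.IsPlanar.rowStep`; listed as "not here" in `RowStatePlanar.lean`),
i.e. the irreducibility input for the marked / unmarked blocks of `planarTransfer`.

Proof, block by block (a *block* is a class of ≥ 2 sites without `⋆`; its span is `[u, v]`):
`d2_reach` is a strong induction, for any order-convex column set `S`, on the number `N` of
sites joined to another point but not to `⋆`. If `N = 0` the pattern is `vertRel B⋆ ⊤`, `B⋆`
its set of `⋆`-joined sites (one step `(B⋆, ∅)` from `wired`), resp. `free` itself (no step).
Otherwise `d2_exists_block` gives an innermost block `B` (every site strictly inside its span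
and outside `B` is a singleton: a least-span class among those of candidate sites — this is
where non-crossing enters, through `IsNonCrossing.mem_Ioo_of_rel` and `⋆` being the rightmost
boundary point); dissolving it (`vertRel (univ \ B)`, planar by `IsNonCrossing.vertRel`) keeps
the `⋆`-class and lowers `N` (`d2_dissolve_block`); the dissolved pattern is reached by
induction, and the two further steps `(univ, [u, v))`, `({y | u < y < v → y ∈ B}, ∅)` rebuild
`B` (`d2_rebuild_block`, via `d2_horizRel_run`: joining a run of singletons merges exactly it).

Sources: folklore (non-crossing partitions: G. Kreweras, Discrete Math. 1 (1972) 333–350; planar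
connectivity states of the percolation transfer matrix: J. L. Jacobsen, P. Zinn-Justin,
arXiv:cond-mat/0111374, §4). No named facts are used.
-/

noncomputable section

namespace Summit.CriticalPhenomena.CardyFormulaZ2.Cruxes.StripClusterRates.TwoClusterRateIsStationaryGap

open Filter Topology
open scoped BigOperators Classical
open Literature.Probability.Percolation Literature.Probability.LatticeModels

/-- **Joining a run of singletons.** If every site of the integer interval `[u, v] ⊆ S` is a
singleton class of `ρ`, opening the horizontal bonds `{y, y+1}`, `u ≤ y < v`, merges exactly the
sites of `[u, v]` into one class and changes nothing else. [folklore] -/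
theorem d2_horizRel_run {S : Finset ℤ} (ρ : Setoid (RowPoint S)) (u v : ℤ) (huv : u ≤ v) :
    (∀ z, u ≤ z → z ≤ v → z ∈ S) →
    (∀ z : S, u ≤ (z : ℤ) → (z : ℤ) ≤ v →
      ∀ a, ρ (Sum.inl z) a → a = Sum.inl z) →
    ∀ a b : RowPoint S,
      horizRel (Finset.univ.filter fun y : S => u ≤ (y : ℤ) ∧ (y : ℤ) < v) ρ a b ↔
        ρ a b ∨ ((∃ y : S, a = Sum.inl y ∧ u ≤ (y : ℤ) ∧ (y : ℤ) ≤ v) ∧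
          (∃ y : S, b = Sum.inl y ∧ u ≤ (y : ℤ) ∧ (y : ℤ) ≤ v)) := by
  induction v, huv using Int.leInduction with
  | base =>
    intro _ _ a b
    rw [show (Finset.univ.filter fun y : S => u ≤ (y : ℤ) ∧ (y : ℤ) < u) = ∅ from
      Finset.filter_eq_empty_iff.2 fun y _ h => by omega, horizRel_empty]
    refine ⟨Or.inl, ?_⟩
    rintro (h | ⟨⟨ya, rfl, hya⟩, ⟨yb, rfl, hyb⟩⟩)
    · exact h
    · exact (Subtype.ext (by omega) : ya = yb) ▸ ρ.refl' _
  | succ v huv ih =>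
    intro hS hiso a b
    obtain ⟨w, hw⟩ : ∃ w : S, (w : ℤ) = v := ⟨⟨v, hS v huv (by omega)⟩, rfl⟩
    obtain ⟨w', hw'⟩ : ∃ w' : S, (w' : ℤ) = v + 1 :=
      ⟨⟨v + 1, hS (v + 1) (by omega) le_rfl⟩, rfl⟩
    have hwS : (w : ℤ) + 1 ∈ S := by rw [hw, ← hw']; exact w'.2
    have ih' := ih (fun z h1 h2 => hS z h1 (by omega)) (fun z h1 h2 => hiso z h1 (by omega))
    rw [show (Finset.univ.filter fun y : S => u ≤ (y : ℤ) ∧ (y : ℤ) < v + 1) =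
        insert w (Finset.univ.filter fun y : S => u ≤ (y : ℤ) ∧ (y : ℤ) < v) by
      ext y
      simp only [Finset.mem_filter, Finset.mem_univ, true_and, Finset.mem_insert,
        Subtype.ext_iff]
      omega, horizRel_insert, joinRel_apply w hwS,
      show (⟨(w : ℤ) + 1, hwS⟩ : S) = w' from Subtype.ext (by simp only [hw, hw'])]
    have h1 : ∀ c,
        horizRel (Finset.univ.filter fun y : S => u ≤ (y : ℤ) ∧ (y : ℤ) < v) ρ c
            (Sum.inl w) ↔
          ∃ y : S, c = Sum.inl y ∧ u ≤ (y : ℤ) ∧ (y : ℤ) ≤ v := fun c => by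
      rw [ih' c (Sum.inl w)]
      refine ⟨?_, fun h => Or.inr ⟨h, w, rfl, by omega, by omega⟩⟩
      rintro (h | ⟨h, -⟩)
      · exact ⟨w, hiso w (by omega) (by omega) c (ρ.symm' h), by omega, by omega⟩
      · exact h
    have h2 : ∀ c,
        horizRel (Finset.univ.filter fun y : S => u ≤ (y : ℤ) ∧ (y : ℤ) < v) ρ c
            (Sum.inl w') ↔
          c = Sum.inl w' := fun c => by
      rw [ih' c (Sum.inl w')]
      refine ⟨?_, fun h => Or.inl (h ▸ ρ.refl' _)⟩
      rintro (h | ⟨-, y, hy, -, hyv⟩)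
      · exact hiso w' (by omega) (by omega) c (ρ.symm' h)
      · have := congrArg Subtype.val (Sum.inl_injective hy)
        omega
    have h3 : ∀ c : RowPoint S,
        (∃ y : S, c = Sum.inl y ∧ u ≤ (y : ℤ) ∧ (y : ℤ) ≤ v + 1) ↔
          (∃ y : S, c = Sum.inl y ∧ u ≤ (y : ℤ) ∧ (y : ℤ) ≤ v) ∨
            c = Sum.inl w' := by
      refine fun c => ⟨?_, ?_⟩
      · rintro ⟨y, rfl, hy1, hy2⟩
        by_cases hyv : (y : ℤ) ≤ v
        · exact Or.inl ⟨y, rfl, hy1, hyv⟩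
        · exact Or.inr (congrArg Sum.inl (Subtype.ext (by omega)))
      · rintro (⟨y, rfl, hy1, hy2⟩ | rfl)
        · exact ⟨y, rfl, hy1, by omega⟩
        · exact ⟨w', rfl, by omega, by omega⟩
    rw [ih' a b, h1 a, h1 b, h2 a, h2 b, h3 a, h3 b]
    exact ⟨fun h => h.elim (fun h => h.elim Or.inl fun h => Or.inr ⟨Or.inl h.1, Or.inl h.2⟩)
      Or.inr, fun h => h.elim (fun h => Or.inl (Or.inl h)) Or.inr⟩

/-- **Rebuilding a dissolved block in two row steps.** Let `B` be a class of `q` made of sites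
only, with leftmost site `u` and rightmost site `v`, every site strictly between them outside `B`
being a singleton of `q`. From `q` with `B` dissolved (`vertRel (univ \ B)`), the step (all
vertical bonds, horizontal bonds `[u, v)`) followed by the step (vertical bonds exactly off
`(u, v) \ B`, no horizontal bond) gives back `q`. [folklore] -/
theorem d2_rebuild_block {S : Finset ℤ} (q : Setoid (RowPoint S)) (B : Finset S) (u v : S)
    (hS : ∀ z, (u : ℤ) ≤ z → z ≤ v → z ∈ S)
    (hB : ∀ y ∈ B, ∀ a, q (Sum.inl y) a ↔ ∃ y' ∈ B, a = Sum.inl y')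
    (hu : u ∈ B) (hv : v ∈ B) (hspan : ∀ y ∈ B, (u : ℤ) ≤ y ∧ (y : ℤ) ≤ v)
    (hinner : ∀ z : S, (u : ℤ) < z → (z : ℤ) < v → z ∉ B →
      ∀ a, q (Sum.inl z) a → a = Sum.inl z) :
    horizRel ∅
      (vertRel (Finset.univ.filter fun y : S => (u : ℤ) < y → (y : ℤ) < v → y ∈ B)
        (horizRel (Finset.univ.filter fun y : S => (u : ℤ) ≤ y ∧ (y : ℤ) < v)
          (vertRel Finset.univ (vertRel (Finset.univ \ B) q)))) = q := by
  rw [horizRel_empty, vertRel_univ]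
  -- bookkeeping on the class `B`
  have hBstar : ∀ y ∈ B, ¬ q (Sum.inl y) (Sum.inr ()) := fun y hy h => by
    obtain ⟨y', -, ⟨⟩⟩ := (hB y hy _).1 h
  have hBmem : ∀ y ∈ B, ∀ y' : S, q (Sum.inl y) (Sum.inl y') → y' ∈ B :=
      fun y hy y' h => by
    obtain ⟨y'', hy'', e⟩ := (hB y hy _).1 h
    exact Sum.inl_injective e ▸ hy''
  have hnotB : ∀ y : S, y ∉ B ↔ IsUp (Finset.univ \ B) (Sum.inl y) := fun y =>
    (and_iff_right (Finset.mem_univ y)).symm.trans Finset.mem_sdiff.symm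
  -- every site of `[u, v]` is a singleton of the dissolved pattern
  have hiso : ∀ z : S, (u : ℤ) ≤ z → (z : ℤ) ≤ v →
      ∀ a, vertRel (Finset.univ \ B) q (Sum.inl z) a → a = Sum.inl z := by
    rintro z h1 h2 a (h | ⟨hz, -, hza⟩)
    · exact h.symm
    rw [← hnotB] at hz
    exact hinner z (lt_of_le_of_ne h1 fun h => hz (Subtype.ext h ▸ hu))
      (lt_of_le_of_ne h2 fun h => hz ((Subtype.ext h).symm ▸ hv)) hz a hza
  -- membership in the second vertical configuration
  have hO : ∀ y : S,
      IsUp (Finset.univ.filter fun y : S => (u : ℤ) < y → (y : ℤ) < v → y ∈ B)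
        (Sum.inl y) ↔ ((u : ℤ) < y → (y : ℤ) < v → y ∈ B) := fun y =>
    Finset.mem_filter.trans (and_iff_right (Finset.mem_univ _))
  have hmemB : ∀ y : S, ((u : ℤ) < y → (y : ℤ) < v → y ∈ B) →
      (u : ℤ) ≤ y → (y : ℤ) ≤ v → y ∈ B := fun y h h1 h2 => by
    by_contra hyB
    exact hyB (h (lt_of_le_of_ne h1 fun e => hyB (Subtype.ext e ▸ hu))
      (lt_of_le_of_ne h2 fun e => hyB ((Subtype.ext e).symm ▸ hv)))
  have hup : ∀ y : S, y ∉ B → ∀ c, q (Sum.inl y) c → c ≠ Sum.inl y →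
      ((u : ℤ) < y → (y : ℤ) < v → y ∈ B) :=
    fun y hyB c hc hne h1 h2 => absurd (hinner y h1 h2 hyB c hc) hne
  ext a b
  show vertRel _ (horizRel _ (vertRel (Finset.univ \ B) q)) a b ↔ q a b
  rw [vertRel_apply, d2_horizRel_run (vertRel (Finset.univ \ B) q) u v (hspan u hu).2 hS hiso a b,
    vertRel_apply]
  rcases a with ya | ⟨⟨⟩⟩ <;> rcases b with yb | ⟨⟨⟩⟩
  · by_cases hab : ya = yb
    · exact iff_of_true (Or.inl (hab ▸ rfl)) (hab ▸ q.refl' _)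
    have hab' : Sum.inl ya ≠ (Sum.inl yb : RowPoint S) := fun h => hab (Sum.inl_injective h)
    constructor
    · rintro (h | ⟨hya, hyb, (h | ⟨-, -, h⟩) |
        ⟨⟨ya', hya', ha1, ha2⟩, ⟨yb', hyb', hb1, hb2⟩⟩⟩)
      · exact absurd h hab'
      · exact absurd h hab'
      · exact h
      · cases Sum.inl_injective hya'
        cases Sum.inl_injective hyb'
        exact (hB ya (hmemB ya ((hO ya).1 hya) ha1 ha2) _).2
          ⟨yb, hmemB yb ((hO yb).1 hyb) hb1 hb2, rfl⟩
    · intro hq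
      by_cases hyaB : ya ∈ B
      · have hybB : yb ∈ B := hBmem ya hyaB yb hq
        exact Or.inr ⟨(hO ya).2 fun _ _ => hyaB, (hO yb).2 fun _ _ => hybB,
          Or.inr ⟨⟨ya, rfl, hspan ya hyaB⟩, ⟨yb, rfl, hspan yb hybB⟩⟩⟩
      · have hybB : yb ∉ B := fun h => hyaB (hBmem yb h ya (q.symm' hq))
        exact Or.inr ⟨(hO ya).2 (hup ya hyaB _ hq hab'.symm),
          (hO yb).2 (hup yb hybB _ (q.symm' hq) hab'),
          Or.inl (Or.inr ⟨(hnotB ya).1 hyaB, (hnotB yb).1 hybB, hq⟩)⟩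
  · constructor
    · rintro (h | ⟨-, -, (h | ⟨-, -, h⟩) | ⟨-, y, hy, -⟩⟩) <;>
        first | exact h | cases h | cases hy
    · intro hq
      have hyaB : ya ∉ B := fun h => hBstar ya h hq
      exact Or.inr ⟨(hO ya).2 (hup ya hyaB _ hq Sum.inr_ne_inl), trivial,
        Or.inl (Or.inr ⟨(hnotB ya).1 hyaB, trivial, hq⟩)⟩
  · constructor
    · rintro (h | ⟨-, -, (h | ⟨-, -, h⟩) | ⟨⟨y, hy, -⟩, -⟩⟩) <;>
        first | exact h | cases h | cases hy
    · intro hq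
      have hybB : yb ∉ B := fun h => hBstar yb h (q.symm' hq)
      exact Or.inr ⟨trivial, (hO yb).2 (hup yb hybB _ (q.symm' hq) Sum.inr_ne_inl),
        Or.inl (Or.inr ⟨trivial, (hnotB yb).1 hybB, hq⟩)⟩
  · exact iff_of_true (Or.inl rfl) (q.refl' _)

/-- **An innermost block.** In a non-crossing pattern with a site `a₀` joined to another point
but not to `⋆`, some class `B` of sites (no `⋆`), with leftmost site `u` and rightmost site
`v ≠ u`, has every site strictly between `u` and `v` outside `B` a singleton: a least-span class
among the classes of such sites (a class met strictly inside the span is nested in it by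
`IsNonCrossing.mem_Ioo_of_rel`; a `⋆`-joined site strictly inside would cross `u ~ v`).
[folklore] -/
theorem d2_exists_block {S : Finset ℤ} (q : Setoid (RowPoint S)) (hq : IsNonCrossing q)
    (a₀ : S) (ha₀ : ∃ b, q (Sum.inl a₀) b ∧ b ≠ Sum.inl a₀)
    (ha₀' : ¬ q (Sum.inl a₀) (Sum.inr ())) :
    ∃ (B : Finset S) (u v : S),
      (∀ y ∈ B, ∀ a, q (Sum.inl y) a ↔ ∃ y' ∈ B, a = Sum.inl y') ∧
      u ∈ B ∧ v ∈ B ∧ u ≠ v ∧ (∀ y ∈ B, (u : ℤ) ≤ y ∧ (y : ℤ) ≤ v) ∧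
      (∀ z : S, (u : ℤ) < z → (z : ℤ) < v → z ∉ B →
        ∀ a, q (Sum.inl z) a → a = Sum.inl z) := by
  -- the class of a site, as a set of sites
  set cl : S → Finset S := fun a => Finset.univ.filter fun y : S => q (Sum.inl a) (Sum.inl y)
    with hcl
  have hmem_cl : ∀ a y : S, y ∈ cl a ↔ q (Sum.inl a) (Sum.inl y) := fun a y => by simp [hcl]
  have hne : ∀ a, (cl a).Nonempty := fun a => ⟨a, (hmem_cl a a).2 (q.refl' _)⟩
  -- a candidate site of least span
  obtain ⟨a, ha, hmin⟩ := Finset.exists_min_image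
    (Finset.univ.filter fun a : S => (∃ b, q (Sum.inl a) b ∧ b ≠ Sum.inl a) ∧
      ¬ q (Sum.inl a) (Sum.inr ()))
    (fun a => ((cl a).max' (hne a) : ℤ) - ((cl a).min' (hne a) : ℤ))
    ⟨a₀, Finset.mem_filter.2 ⟨Finset.mem_univ _, ha₀, ha₀'⟩⟩
  obtain ⟨-, ⟨b, hab, hba⟩, hastar⟩ := Finset.mem_filter.1 ha
  have hu := (hmem_cl a _).1 (Finset.min'_mem (cl a) (hne a))
  refine ⟨cl a, (cl a).min' (hne a), (cl a).max' (hne a), fun y hy c => ?_, Finset.min'_mem _ _,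
    Finset.max'_mem _ _, ?_, fun y hy => ⟨Subtype.coe_le_coe.2 (Finset.min'_le _ _ hy),
      Subtype.coe_le_coe.2 (Finset.le_max' _ _ hy)⟩, fun z huz hzv hzB c hzc => ?_⟩
  · -- `cl a` is a whole class and misses `⋆`
    rw [hmem_cl] at hy
    refine ⟨fun hyc => ?_,
      fun ⟨y', hy', e⟩ => e ▸ q.trans' (q.symm' hy) ((hmem_cl a y').1 hy')⟩
    rcases c with y' | ⟨⟨⟩⟩
    · exact ⟨y', (hmem_cl a y').2 (q.trans' hy hyc), rfl⟩
    · exact absurd (q.trans' hy hyc) hastar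
  · -- two distinct sites
    refine ne_of_lt (Finset.min'_lt_max'_of_card _ ?_)
    rcases b with y | ⟨⟨⟩⟩
    · exact Finset.one_lt_card.2 ⟨a, (hmem_cl a a).2 (q.refl' _), y, (hmem_cl a y).2 hab,
        fun h => hba (congrArg Sum.inl h.symm)⟩
    · exact absurd hab hastar
  · by_contra hcz
    have huv : q (Sum.inl ((cl a).min' (hne a))) (Sum.inl ((cl a).max' (hne a))) :=
      q.trans' (q.symm' hu) ((hmem_cl a _).1 (Finset.max'_mem _ _))
    have huz' : ¬ q (Sum.inl ((cl a).min' (hne a))) (Sum.inl z) := fun h =>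
      hzB ((hmem_cl a z).2 (q.trans' hu h))
    -- `z` is not joined to `⋆` (that would cross `u ~ v`), so it is a candidate ...
    have hz := hmin z (Finset.mem_filter.2 ⟨Finset.mem_univ _, ⟨c, hzc, hcz⟩, fun h =>
      huz' (hq (Sum.inl _) (Sum.inl z) (Sum.inl _) (Sum.inr ()) huz hzv
        (lt_starPos ((cl a).max' (hne a)).2) huv h)⟩)
    -- ... but its class lies strictly inside `(u, v)`
    have hin : ∀ w ∈ cl z,
        ((cl a).min' (hne a) : ℤ) < w ∧ (w : ℤ) < (cl a).max' (hne a) := fun w hw =>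
      hq.mem_Ioo_of_rel (a := Sum.inl _) (b := Sum.inl z) (c := Sum.inl _) (w := Sum.inl w)
        huz hzv huv huz' ((hmem_cl z w).1 hw)
    have h1 := hin _ (Finset.max'_mem (cl z) (hne z))
    have h2 := hin _ (Finset.min'_mem (cl z) (hne z))
    omega

/-- **Dissolving a block.** Dissolving a class `B` of sites with two distinct elements into
singletons keeps the set of sites joined to `⋆` and strictly decreases the number of sites joined
to another point but not to `⋆`. [folklore] -/
theorem d2_dissolve_block {S : Finset ℤ} (q : Setoid (RowPoint S)) (B : Finset S)
    (hB : ∀ y ∈ B, ∀ a, q (Sum.inl y) a ↔ ∃ y' ∈ B, a = Sum.inl y') {u v : S}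
    (hu : u ∈ B) (hv : v ∈ B) (huv : u ≠ v) :
    (∀ y : S, vertRel (Finset.univ \ B) q (Sum.inl y) (Sum.inr ()) ↔
        q (Sum.inl y) (Sum.inr ())) ∧
      (Finset.univ.filter fun y : S =>
          (∃ b, vertRel (Finset.univ \ B) q (Sum.inl y) b ∧ b ≠ Sum.inl y) ∧
            ¬ vertRel (Finset.univ \ B) q (Sum.inl y) (Sum.inr ())).card <
        (Finset.univ.filter fun y : S =>
          (∃ b, q (Sum.inl y) b ∧ b ≠ Sum.inl y) ∧ ¬ q (Sum.inl y) (Sum.inr ())).card := by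
  have hBstar : ∀ y ∈ B, ¬ q (Sum.inl y) (Sum.inr ()) := fun y hy h => by
    obtain ⟨y', -, ⟨⟩⟩ := (hB y hy _).1 h
  have hstar : ∀ y : S, vertRel (Finset.univ \ B) q (Sum.inl y) (Sum.inr ()) ↔
      q (Sum.inl y) (Sum.inr ()) := by
    refine fun y => ⟨?_, fun h => Or.inr
      ⟨Finset.mem_sdiff.2 ⟨Finset.mem_univ _, fun hyB => hBstar y hyB h⟩, trivial, h⟩⟩
    rintro (h | ⟨-, -, h⟩) <;> first | exact h | cases h
  refine ⟨hstar, Finset.card_lt_card ((Finset.ssubset_iff_of_subset fun y hy => ?_).2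
    ⟨u, ?_, fun h => ?_⟩)⟩
  · simp only [Finset.mem_filter, Finset.mem_univ, true_and] at hy ⊢
    obtain ⟨⟨b, hb, hne⟩, hys⟩ := hy
    exact ⟨⟨b, vertRel_le _ _ hb, hne⟩, fun h => hys ((hstar y).2 h)⟩
  · simp only [Finset.mem_filter, Finset.mem_univ, true_and]
    exact ⟨⟨Sum.inl v, (hB u hu _).2 ⟨v, hv, rfl⟩,
      fun h => huv (Sum.inl_injective h).symm⟩, hBstar u hu⟩
  · obtain ⟨-, ⟨b, hb, hne⟩, -⟩ := Finset.mem_filter.1 h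
    rcases (vertRel_apply _ _ _ _).1 hb with h | ⟨hu', -, -⟩
    · exact hne h.symm
    · exact (Finset.mem_sdiff.1 hu').2 hu

/-- **Planar reachability over an order-convex set of columns**, by strong induction on the number
`N` of sites joined to another point but not to `⋆` (see the module docstring). [folklore] -/
theorem d2_reach {S : Finset ℤ}
    (hS : ∀ a ∈ S, ∀ b ∈ S, ∀ z, a ≤ z → z ≤ b → z ∈ S) :
    ∀ (N : ℕ) (q : PlanarRowState S),
      (Finset.univ.filter fun y : S => (∃ b, q.1.rel (Sum.inl y) b ∧ b ≠ Sum.inl y) ∧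
          ¬ q.1.rel (Sum.inl y) (Sum.inr ())).card = N →
      ((∃ x, q.1.JoinedToStar x) → ∃ l : List (Finset S × Finset S),
          l.foldl (fun r OH => planarRowStep OH.1 OH.2 r) (PlanarRowState.wired S) = q) ∧
      ((∀ x, ¬ q.1.JoinedToStar x) → ∃ l : List (Finset S × Finset S),
          l.foldl (fun r OH => planarRowStep OH.1 OH.2 r)
            ⟨RowState.free S, RowState.isPlanar_free S⟩ = q) := by
  intro N
  induction N using Nat.strong_induction_on with
  | _ N ih =>
  intro q hN
  by_cases h0 : ∃ a₀ : S, (∃ b, q.1.rel (Sum.inl a₀) b ∧ b ≠ Sum.inl a₀) ∧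
      ¬ q.1.rel (Sum.inl a₀) (Sum.inr ())
  · -- inductive case: dissolve an innermost block and rebuild it
    obtain ⟨a₀, ha₀, ha₀'⟩ := h0
    obtain ⟨B, u, v, hB, hu, hv, huv, hspan, hinner⟩ :=
      d2_exists_block q.1.rel q.2 a₀ ha₀ ha₀'
    obtain ⟨hstar, hlt⟩ := d2_dissolve_block q.1.rel B hB hu hv huv
    set q' : PlanarRowState S :=
      ⟨⟨vertRel (Finset.univ \ B) q.1.rel⟩, IsNonCrossing.vertRel q.2 _⟩
    have ih' := ih _ (lt_of_lt_of_eq hlt hN) q' rfl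
    have key : ∀ l : List (Finset S × Finset S), ∀ p : PlanarRowState S,
        l.foldl (fun r OH => planarRowStep OH.1 OH.2 r) p = q' →
        (l ++ [(Finset.univ, Finset.univ.filter fun y : S => (u : ℤ) ≤ y ∧ (y : ℤ) < v),
          (Finset.univ.filter fun y : S => (u : ℤ) < y → (y : ℤ) < v → y ∈ B, ∅)]).foldl
            (fun r OH => planarRowStep OH.1 OH.2 r) p = q := by
      intro l p hl
      rw [List.foldl_append, hl, List.foldl_cons, List.foldl_cons, List.foldl_nil]
      exact Subtype.ext (RowState.ext (d2_rebuild_block q.1.rel B u v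
        (fun z h1 h2 => hS u u.2 v v.2 z h1 h2) hB hu hv hspan hinner))
    constructor
    · rintro ⟨x, hx⟩
      obtain ⟨l, hl⟩ := ih'.1 ⟨x, (hstar x).2 hx⟩
      exact ⟨_, key l _ hl⟩
    · intro hum
      obtain ⟨l, hl⟩ := ih'.2 fun x hx => hum x ((hstar x).1 hx)
      exact ⟨_, key l _ hl⟩
  · -- base case: every site is a singleton or joined to `⋆`
    have h0' : ∀ (a₀ : S) (b : RowPoint S), q.1.rel (Sum.inl a₀) b → b ≠ Sum.inl a₀ →
        q.1.rel (Sum.inl a₀) (Sum.inr ()) :=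
      fun a₀ b hb hne => by_contra fun hs => h0 ⟨a₀, ⟨b, hb, hne⟩, hs⟩
    refine ⟨fun _ => ⟨[(Finset.univ.filter fun y : S => q.1.rel (Sum.inl y) (Sum.inr ()), ∅)],
      Subtype.ext (RowState.ext ?_)⟩, fun hum => ⟨[], Subtype.ext (RowState.ext ?_)⟩⟩
    · show horizRel ∅ (vertRel _ (RowState.wired S).rel) = q.1.rel
      rw [horizRel_empty]
      have hBs : ∀ y : S,
          IsUp (Finset.univ.filter fun y : S => q.1.rel (Sum.inl y) (Sum.inr ())) (Sum.inl y) ↔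
            q.1.rel (Sum.inl y) (Sum.inr ()) := fun y =>
        Finset.mem_filter.trans (and_iff_right (Finset.mem_univ _))
      ext a b
      rw [vertRel_apply]
      rcases a with ya | ⟨⟨⟩⟩ <;> rcases b with yb | ⟨⟨⟩⟩
      · refine ⟨?_, fun hq => ?_⟩
        · rintro (h | ⟨ha, hb, -⟩)
          · exact h ▸ q.1.rel.refl' _
          · exact q.1.rel.trans' ((hBs ya).1 ha) (q.1.rel.symm' ((hBs yb).1 hb))
        · by_cases hab : ya = yb
          · exact Or.inl (hab ▸ rfl)
          have ha : q.1.rel (Sum.inl ya) (Sum.inr ()) :=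
            h0' ya _ hq fun h => hab (Sum.inl_injective h).symm
          exact Or.inr
            ⟨(hBs ya).2 ha, (hBs yb).2 (q.1.rel.trans' (q.1.rel.symm' hq) ha), trivial⟩
      · refine ⟨?_, fun hq => Or.inr ⟨(hBs ya).2 hq, trivial, trivial⟩⟩
        rintro (h | ⟨ha, -, -⟩) <;> first | exact (hBs ya).1 ha | cases h
      · refine ⟨?_, fun hq => Or.inr ⟨trivial, (hBs yb).2 (q.1.rel.symm' hq), trivial⟩⟩
        rintro (h | ⟨-, hb, -⟩) <;> first | exact q.1.rel.symm' ((hBs yb).1 hb) | cases h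
      · exact iff_of_true (Or.inl rfl) (q.1.rel.refl' _)
    · show (RowState.free S).rel = q.1.rel
      ext a b
      refine ⟨fun h => (h : a = b) ▸ q.1.rel.refl' _, fun hq => show a = b from ?_⟩
      rcases a with ya | ⟨⟨⟩⟩ <;> rcases b with yb | ⟨⟨⟩⟩
      · by_contra hab
        exact hum ya (h0' ya _ hq fun h => hab h.symm)
      · exact absurd hq (hum ya)
      · exact absurd (q.1.rel.symm' hq) (hum yb)
      · rfl

/-- **D2 · planar reachability** (`= PlanarReachable` of the line file): every planar pattern of
the row `Finset.Icc 0 n ⊔ {⋆}` with some site joined to `⋆` is an iterate of row steps applied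
to `wired`, and every planar pattern with no site joined to `⋆` an iterate of row steps applied
to `free` — the converse of "row steps preserve planarity" (`RowState.IsPlanar.rowStep`), i.e.
the irreducibility input for the marked / unmarked blocks of `planarTransfer`. Proof: `d2_reach`
(block-by-block construction, two steps per block). [folklore] -/
theorem stub_planarReachable :
    (∀ (n : ℕ) (q : PlanarRowState (Finset.Icc (0 : ℤ) n)), (∃ x, q.1.JoinedToStar x) →
      ∃ l : List (Finset (Finset.Icc (0 : ℤ) n) × Finset (Finset.Icc (0 : ℤ) n)),
        l.foldl (fun r OH => planarRowStep OH.1 OH.2 r) (PlanarRowState.wired (Finset.Icc (0 : ℤ) n)) = q) ∧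
    (∀ (n : ℕ) (q : PlanarRowState (Finset.Icc (0 : ℤ) n)), (∀ x, ¬ q.1.JoinedToStar x) →
      ∃ l : List (Finset (Finset.Icc (0 : ℤ) n) × Finset (Finset.Icc (0 : ℤ) n)),
        l.foldl (fun r OH => planarRowStep OH.1 OH.2 r)
          ⟨RowState.free (Finset.Icc (0 : ℤ) n), RowState.isPlanar_free (Finset.Icc (0 : ℤ) n)⟩ = q) := by
  have hS : ∀ n : ℕ, ∀ a ∈ Finset.Icc (0 : ℤ) n, ∀ b ∈ Finset.Icc (0 : ℤ) n,
      ∀ z, a ≤ z → z ≤ b → z ∈ Finset.Icc (0 : ℤ) n := by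
    intro n a ha b hb z h1 h2
    rw [Finset.mem_Icc] at ha hb ⊢
    omega
  exact ⟨fun n q hq => (d2_reach (hS n) _ q rfl).1 hq,
    fun n q hq => (d2_reach (hS n) _ q rfl).2 hq⟩

end Summit.CriticalPhenomena.CardyFormulaZ2.Cruxes.StripClusterRates.TwoClusterRateIsStationaryGap
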